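import Summits.Ventures.PercRepro.RankLevelSetExplicitLin2KeyL
import Summits.Ventures.PercRepro.RankLevelSetExplicitLin2TailOptimal
import Summits.Ventures.PercRepro.RankLevelSetExplicitLin2CubeFloor
import Summits.Ventures.PercRepro.RankLevelSetExplicitLin2IndepRowSTen
import Summits.Ventures.PercRepro.RankLevelSetExplicitLin2IndepRowSEleven
import Summits.Ventures.PercRepro.RankLevelSetExplicitLin2IndepRowSTwelve
import Summits.Ventures.PercRepro.RankLevelSetExplicitLin2IndepRowSThirteen
import Summits.Ventures.PercRepro.RankLevelSetExplicitLin2IndepRowSFourteen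
import Summits.Ventures.PercRepro.RankLevelSetExplicitLin2IndepRowSFifteen
import Summits.Ventures.PercRepro.RankLevelSetExplicitLin2IndepRowSSixteen
import Summits.Ventures.PercRepro.RankLevelSetLevelNineCube

/-!
# PercRepro — THE SHARP THEOREM-M FLOOR TABLE: THE SEVEN ROWS AT THE OPTIMAL-CHERNOFF TAILS, THE THRESHOLD OF RECORD AT EVERY
LEVEL `q ≥ 7`, AND THE CRUX AS ITS WINDOWS BELOW THEM (p4, S4 feed)

`proofs/P4-gen18.md` §4. The THEOREM-M rows (RankLevelSetExplicitLin2KeyL) with the `(Y)`-tail from ONE kernel evaluation at the top core corank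
(RankLevelSetExplicitLin2TailOptimal: the optimal Chernoff pair `16·n₀^{n₀} ≤ 2^{n₀}·(n₀ − K₀)^{n₀−K₀}·K₀^{K₀}` at `n₀ = p₀ + D`,
`K₀ = q + D`, `D = q + 2^q`, transferred down the coranks and up the rank) in place of the fixed Chernoff pair of
RankLevelSetExplicitLin2LevelTail (the rows at that pair: RankLevelSetExplicitLin2IndepRowTen … Sixteen, assembly …IndepFloor): the rows
RankLevelSetExplicitLin2IndepRowSTen … IndepRowSSixteen at `p₀ = 1 165 / 2 236 / 4 349 / 8 536 / 16 856 / 33 419 / 66 440` (the least `p` with the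
kernel inequality; from `1 212 / 2 367 / 4 674 / 9 286 / 18 505 / 36 940 / 73 807`), composed from p4's level-9 cube row
`c025_nine_large_cube'` (`382 ≤ p`) into `c025_ten_indepS_from_1165 … c025_sixteen_indepS_from_66440`; `PfloorLS`, `c025_floorLS`,
`c025_of_window_floorLS`. The key's own floors `1 089 / 1 555 / 2 135 / 2 992 / 4 093 / 5 784 / 8 220` stay below: the tail binds.
Axioms: standard.
-/

open scoped Matroid

namespace PercRepro

namespace ThmN

variable {α : Type}

/-- **THE LEVEL FROM ONE EVALUATED THEOREM-M ROW, WITH THE TAIL FROM ONE KERNEL EVALUATION AT THE TOP CORANK**: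
`c025_level_succ_of_key_row_tailOpt` for the key `KeyL (q + 1)` (the core cell `c025_core_lin2_of_keyL_tail`, `keyL_succ`). -/
theorem c025_level_succ_of_keyL_row_tailOpt (q : ℕ) (hq : 7 ≤ q) (p₀ N₁ P₂ : ℕ)
    (hN₁ : N₁ ≤ p₀) (hm : 2 * (q + 1) ≤ N₁)
    (hbase₁ : 8 * (q + 1 + 1) * 2 ^ (2 ^ (q + 1) - 1 - (q + 1)) * N₁ ^ (q + 1) ≤ 2 ^ N₁)
    (hP₂ : P₂ ≤ p₀) (hP₂q : q + 1 + 2 ≤ P₂)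
    (hbase₂ : 2 ^ (P₂ + (q + 1)) * 2 ^ (2 ^ (q + 1) - 1 - (q + 1)) * (2 * (P₂ - 1 - (q + 1)) + 1) ≤
      4 ^ (P₂ - 1 - (q + 1)))
    (hp3 : 2 ^ (q + 1) + 2 ≤ p₀)
    (hK₀ : 2 * (q + 1 + (q + 1 + 2 ^ (q + 1))) ≤ p₀ + (q + 1 + 2 ^ (q + 1)))
    (htop : 16 * (p₀ + (q + 1 + 2 ^ (q + 1))) ^ (p₀ + (q + 1 + 2 ^ (q + 1))) ≤
      2 ^ (p₀ + (q + 1 + 2 ^ (q + 1))) *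
        ((p₀ + (q + 1 + 2 ^ (q + 1)) - (q + 1 + (q + 1 + 2 ^ (q + 1)))) ^
            (p₀ + (q + 1 + 2 ^ (q + 1)) - (q + 1 + (q + 1 + 2 ^ (q + 1)))) *
          (q + 1 + (q + 1 + 2 ^ (q + 1))) ^ (q + 1 + (q + 1 + 2 ^ (q + 1)))))
    (hrow : ∀ t < 2 ^ (q + 1), Explicit.KeyL (q + 1) p₀ (q + 2 + t))
    (hprev : ∀ (M : Matroid α) [M.Finite] (p : ℕ), p₀ - 1 ≤ p → RLS M p q) :
    ∀ (M : Matroid α) [M.Finite] (p : ℕ), p₀ ≤ p → RLS M p (q + 1) :=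
  c025_level_succ_of_key_row_tailOpt q hq p₀ N₁ P₂ (Explicit.KeyL (q + 1)) hN₁ hm hbase₁ hP₂ hP₂q hbase₂ hp3 hK₀ htop
    (fun p d hd h => Explicit.keyL_succ (q + 1) p d hd h)
    (fun M _ p d hd1 hd2 hT hk hR hn hfree =>
      c025_core_lin2_of_keyL_tail (q + 1) (by omega) M p d hd1 hd2 hT hk hR hn hfree)
    hrow hprev

/-- **THE LEVEL-10 SHARP STEP FROM `1 165`**: level `10` for every finite matroid and every `p ≥ 1 165` from level `9` for
every `p ≥ 1 164` — the row `key_ten_indepS_row` at the optimal-Chernoff tail `1 165` (`D = 10 + 2^10`, `n₀ = 2 199`,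
`K₀ = 1 044`; the bases `N₁ = P₂ = 1 165`), all by the kernel. -/
theorem c025_ten_indepS_step (hprev : ∀ (M : Matroid α) [M.Finite] (p : ℕ), 1164 ≤ p → RLS M p 9) :
    ∀ (M : Matroid α) [M.Finite] (p : ℕ), 1165 ≤ p → RLS M p 10 :=
  c025_level_succ_of_keyL_row_tailOpt 9 (by norm_num) 1165 1165 1165 le_rfl (by norm_num) (by decide +kernel) le_rfl
    (by norm_num) (by decide +kernel) (by norm_num) (by norm_num) (by decide +kernel) Explicit.key_ten_indepS_row hprev

/-- **THE LEVEL-10 SHARP ROW FROM `1 165`**: C-025 at level `10` for every finite matroid and every `p ≥ 1 165` (was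
`1 212` at the fixed Chernoff pair, `2 126` quartic, `8 710` saturated) — the step `c025_ten_indepS_step` on the
level-9 row `c025_nine_large_cube'` (`382 ≤ p`) at `p − 1`. -/
theorem c025_ten_indepS_from_1165 (M : Matroid α) [M.Finite] (p : ℕ) (hp : 1165 ≤ p) : RLS M p 10 :=
  c025_ten_indepS_step (fun M' _ p' hp' => c025_nine_large_cube' M' p' (by omega)) M p hp

/-- The same in the literal `C025` body: `phiK p 10 · #U(p, 10) ≤ #Y(p, 10)` for every finite matroid and every `p ≥ 1 165`. -/
theorem c025_ten_indepS_from_1165' (M : Matroid α) [M.Finite] (p : ℕ) (hp : 1165 ≤ p) :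
    phiK p 10 * ({A : Set α | A ⊆ M.E ∧ M.eRk A = (p : ℕ∞) ∧ M.eRk (M.E \ A) = (10 : ℕ∞)}.ncard : ℚ) ≤
      ({A : Set α | A ⊆ M.E ∧ (10 : ℕ∞) < M.eRk A ∧ M.eRk A < (p : ℕ∞)}.ncard : ℚ) :=
  c025_ten_indepS_from_1165 M p hp

/-- **THE LEVEL-11 SHARP STEP FROM `2 236`**: level `11` for every finite matroid and every `p ≥ 2 236` from level `10` for
every `p ≥ 2 235` — the row `key_eleven_indepS_row` at the optimal-Chernoff tail `2 236` (`D = 11 + 2^11`, `n₀ = 4 295`,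
`K₀ = 2 070`; the bases `N₁ = P₂ = 2 236`), all by the kernel. -/
theorem c025_eleven_indepS_step (hprev : ∀ (M : Matroid α) [M.Finite] (p : ℕ), 2235 ≤ p → RLS M p 10) :
    ∀ (M : Matroid α) [M.Finite] (p : ℕ), 2236 ≤ p → RLS M p 11 :=
  c025_level_succ_of_keyL_row_tailOpt 10 (by norm_num) 2236 2236 2236 le_rfl (by norm_num) (by decide +kernel) le_rfl
    (by norm_num) (by decide +kernel) (by norm_num) (by norm_num) (by decide +kernel) Explicit.key_eleven_indepS_row hprev

/-- **THE LEVEL-11 SHARP ROW FROM `2 236`**: C-025 at level `11` for every finite matroid and every `p ≥ 2 236` (was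
`2 367` at the fixed Chernoff pair, `4 309` quartic, `18 780` saturated) — the step `c025_eleven_indepS_step` on the
level-10 row `c025_ten_indepS_from_1165` (`1 165 ≤ p`) at `p − 1`. -/
theorem c025_eleven_indepS_from_2236 (M : Matroid α) [M.Finite] (p : ℕ) (hp : 2236 ≤ p) : RLS M p 11 :=
  c025_eleven_indepS_step (fun M' _ p' hp' => c025_ten_indepS_from_1165 M' p' (by omega)) M p hp

/-- The same in the literal `C025` body: `phiK p 11 · #U(p, 11) ≤ #Y(p, 11)` for every finite matroid and every `p ≥ 2 236`. -/
theorem c025_eleven_indepS_from_2236' (M : Matroid α) [M.Finite] (p : ℕ) (hp : 2236 ≤ p) :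
    phiK p 11 * ({A : Set α | A ⊆ M.E ∧ M.eRk A = (p : ℕ∞) ∧ M.eRk (M.E \ A) = (11 : ℕ∞)}.ncard : ℚ) ≤
      ({A : Set α | A ⊆ M.E ∧ (11 : ℕ∞) < M.eRk A ∧ M.eRk A < (p : ℕ∞)}.ncard : ℚ) :=
  c025_eleven_indepS_from_2236 M p hp

/-- **THE LEVEL-12 SHARP STEP FROM `4 349`**: level `12` for every finite matroid and every `p ≥ 4 349` from level `11` for
every `p ≥ 4 348` — the row `key_twelve_indepS_row` at the optimal-Chernoff tail `4 349` (`D = 12 + 2^12`, `n₀ = 8 457`,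
`K₀ = 4 120`; the bases `N₁ = P₂ = 4 349`), all by the kernel. -/
theorem c025_twelve_indepS_step (hprev : ∀ (M : Matroid α) [M.Finite] (p : ℕ), 4348 ≤ p → RLS M p 11) :
    ∀ (M : Matroid α) [M.Finite] (p : ℕ), 4349 ≤ p → RLS M p 12 :=
  c025_level_succ_of_keyL_row_tailOpt 11 (by norm_num) 4349 4349 4349 le_rfl (by norm_num) (by decide +kernel) le_rfl
    (by norm_num) (by decide +kernel) (by norm_num) (by norm_num) (by decide +kernel) Explicit.key_twelve_indepS_row hprev

/-- **THE LEVEL-12 SHARP ROW FROM `4 349`**: C-025 at level `12` for every finite matroid and every `p ≥ 4 349` (was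
`4 674` at the fixed Chernoff pair, `8 764` quartic, `40 204` saturated) — the step `c025_twelve_indepS_step` on the
level-11 row `c025_eleven_indepS_from_2236` (`2 236 ≤ p`) at `p − 1`. -/
theorem c025_twelve_indepS_from_4349 (M : Matroid α) [M.Finite] (p : ℕ) (hp : 4349 ≤ p) : RLS M p 12 :=
  c025_twelve_indepS_step (fun M' _ p' hp' => c025_eleven_indepS_from_2236 M' p' (by omega)) M p hp

/-- The same in the literal `C025` body: `phiK p 12 · #U(p, 12) ≤ #Y(p, 12)` for every finite matroid and every `p ≥ 4 349`. -/
theorem c025_twelve_indepS_from_4349' (M : Matroid α) [M.Finite] (p : ℕ) (hp : 4349 ≤ p) :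
    phiK p 12 * ({A : Set α | A ⊆ M.E ∧ M.eRk A = (p : ℕ∞) ∧ M.eRk (M.E \ A) = (12 : ℕ∞)}.ncard : ℚ) ≤
      ({A : Set α | A ⊆ M.E ∧ (12 : ℕ∞) < M.eRk A ∧ M.eRk A < (p : ℕ∞)}.ncard : ℚ) :=
  c025_twelve_indepS_from_4349 M p hp

/-- **THE LEVEL-13 SHARP STEP FROM `8 536`**: level `13` for every finite matroid and every `p ≥ 8 536` from level `12` for
every `p ≥ 8 535` — the row `key_thirteen_indepS_row` at the optimal-Chernoff tail `8 536` (`D = 13 + 2^13`, `n₀ = 16 741`,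
`K₀ = 8 218`; the bases `N₁ = P₂ = 8 536`), all by the kernel. -/
theorem c025_thirteen_indepS_step (hprev : ∀ (M : Matroid α) [M.Finite] (p : ℕ), 8535 ≤ p → RLS M p 12) :
    ∀ (M : Matroid α) [M.Finite] (p : ℕ), 8536 ≤ p → RLS M p 13 :=
  c025_level_succ_of_keyL_row_tailOpt 12 (by norm_num) 8536 8536 8536 le_rfl (by norm_num) (by decide +kernel) le_rfl
    (by norm_num) (by decide +kernel) (by norm_num) (by norm_num) (by decide +kernel) Explicit.key_thirteen_indepS_row hprev

/-- **THE LEVEL-13 SHARP ROW FROM `8 536`**: C-025 at level `13` for every finite matroid and every `p ≥ 8 536` (was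
`9 286` at the fixed Chernoff pair, `17 876` quartic, `85 609` saturated) — the step `c025_thirteen_indepS_step` on the
level-12 row `c025_twelve_indepS_from_4349` (`4 349 ≤ p`) at `p − 1`. -/
theorem c025_thirteen_indepS_from_8536 (M : Matroid α) [M.Finite] (p : ℕ) (hp : 8536 ≤ p) : RLS M p 13 :=
  c025_thirteen_indepS_step (fun M' _ p' hp' => c025_twelve_indepS_from_4349 M' p' (by omega)) M p hp

/-- The same in the literal `C025` body: `phiK p 13 · #U(p, 13) ≤ #Y(p, 13)` for every finite matroid and every `p ≥ 8 536`. -/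
theorem c025_thirteen_indepS_from_8536' (M : Matroid α) [M.Finite] (p : ℕ) (hp : 8536 ≤ p) :
    phiK p 13 * ({A : Set α | A ⊆ M.E ∧ M.eRk A = (p : ℕ∞) ∧ M.eRk (M.E \ A) = (13 : ℕ∞)}.ncard : ℚ) ≤
      ({A : Set α | A ⊆ M.E ∧ (13 : ℕ∞) < M.eRk A ∧ M.eRk A < (p : ℕ∞)}.ncard : ℚ) :=
  c025_thirteen_indepS_from_8536 M p hp

/-- **THE LEVEL-14 SHARP STEP FROM `16 856`**: level `14` for every finite matroid and every `p ≥ 16 856` from level `13` for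
every `p ≥ 16 855` — the row `key_fourteen_indepS_row` at the optimal-Chernoff tail `16 856` (`D = 14 + 2^14`, `n₀ = 33 254`,
`K₀ = 16 412`; the bases `N₁ = P₂ = 16 856`), all by the kernel. -/
theorem c025_fourteen_indepS_step (hprev : ∀ (M : Matroid α) [M.Finite] (p : ℕ), 16855 ≤ p → RLS M p 13) :
    ∀ (M : Matroid α) [M.Finite] (p : ℕ), 16856 ≤ p → RLS M p 14 :=
  c025_level_succ_of_keyL_row_tailOpt 13 (by norm_num) 16856 16856 16856 le_rfl (by norm_num) (by decide +kernel) le_rfl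
    (by norm_num) (by decide +kernel) (by norm_num) (by norm_num) (by decide +kernel) Explicit.key_fourteen_indepS_row hprev

/-- **THE LEVEL-14 SHARP ROW FROM `16 856`**: C-025 at level `14` for every finite matroid and every `p ≥ 16 856` (was
`18 505` at the fixed Chernoff pair, `36 535` quartic, `181 515` saturated) — the step `c025_fourteen_indepS_step` on the
level-13 row `c025_thirteen_indepS_from_8536` (`8 536 ≤ p`) at `p − 1`. -/
theorem c025_fourteen_indepS_from_16856 (M : Matroid α) [M.Finite] (p : ℕ) (hp : 16856 ≤ p) : RLS M p 14 :=
  c025_fourteen_indepS_step (fun M' _ p' hp' => c025_thirteen_indepS_from_8536 M' p' (by omega)) M p hp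

/-- The same in the literal `C025` body: `phiK p 14 · #U(p, 14) ≤ #Y(p, 14)` for every finite matroid and every `p ≥ 16 856`. -/
theorem c025_fourteen_indepS_from_16856' (M : Matroid α) [M.Finite] (p : ℕ) (hp : 16856 ≤ p) :
    phiK p 14 * ({A : Set α | A ⊆ M.E ∧ M.eRk A = (p : ℕ∞) ∧ M.eRk (M.E \ A) = (14 : ℕ∞)}.ncard : ℚ) ≤
      ({A : Set α | A ⊆ M.E ∧ (14 : ℕ∞) < M.eRk A ∧ M.eRk A < (p : ℕ∞)}.ncard : ℚ) :=
  c025_fourteen_indepS_from_16856 M p hp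

/-- **THE LEVEL-15 SHARP STEP FROM `33 419`**: level `15` for every finite matroid and every `p ≥ 33 419` from level `14` for
every `p ≥ 33 418` — the row `key_fifteen_indepS_row` at the optimal-Chernoff tail `33 419` (`D = 15 + 2^15`, `n₀ = 66 202`,
`K₀ = 32 798`; the bases `N₁ = P₂ = 33 419`), all by the kernel. -/
theorem c025_fifteen_indepS_step (hprev : ∀ (M : Matroid α) [M.Finite] (p : ℕ), 33418 ≤ p → RLS M p 14) :
    ∀ (M : Matroid α) [M.Finite] (p : ℕ), 33419 ≤ p → RLS M p 15 :=
  c025_level_succ_of_keyL_row_tailOpt 14 (by norm_num) 33419 33419 33419 le_rfl (by norm_num) (by decide +kernel) le_rfl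
    (by norm_num) (by decide +kernel) (by norm_num) (by norm_num) (by decide +kernel) Explicit.key_fifteen_indepS_row hprev

/-- **THE LEVEL-15 SHARP ROW FROM `33 419`**: C-025 at level `15` for every finite matroid and every `p ≥ 33 419` (was
`36 940` at the fixed Chernoff pair, `74 775` quartic, `383 509` saturated) — the step `c025_fifteen_indepS_step` on the
level-14 row `c025_fourteen_indepS_from_16856` (`16 856 ≤ p`) at `p − 1`. -/
theorem c025_fifteen_indepS_from_33419 (M : Matroid α) [M.Finite] (p : ℕ) (hp : 33419 ≤ p) : RLS M p 15 :=
  c025_fifteen_indepS_step (fun M' _ p' hp' => c025_fourteen_indepS_from_16856 M' p' (by omega)) M p hp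

/-- The same in the literal `C025` body: `phiK p 15 · #U(p, 15) ≤ #Y(p, 15)` for every finite matroid and every `p ≥ 33 419`. -/
theorem c025_fifteen_indepS_from_33419' (M : Matroid α) [M.Finite] (p : ℕ) (hp : 33419 ≤ p) :
    phiK p 15 * ({A : Set α | A ⊆ M.E ∧ M.eRk A = (p : ℕ∞) ∧ M.eRk (M.E \ A) = (15 : ℕ∞)}.ncard : ℚ) ≤
      ({A : Set α | A ⊆ M.E ∧ (15 : ℕ∞) < M.eRk A ∧ M.eRk A < (p : ℕ∞)}.ncard : ℚ) :=
  c025_fifteen_indepS_from_33419 M p hp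

/-- **THE LEVEL-16 SHARP STEP FROM `66 440`**: level `16` for every finite matroid and every `p ≥ 66 440` from level `15` for
every `p ≥ 66 439` — the row `key_sixteen_indepS_row` at the optimal-Chernoff tail `66 440` (`D = 16 + 2^16`, `n₀ = 131 992`,
`K₀ = 65 568`; the bases `N₁ = P₂ = 66 440`), all by the kernel. -/
theorem c025_sixteen_indepS_step (hprev : ∀ (M : Matroid α) [M.Finite] (p : ℕ), 66439 ≤ p → RLS M p 15) :
    ∀ (M : Matroid α) [M.Finite] (p : ℕ), 66440 ≤ p → RLS M p 16 :=
  c025_level_succ_of_keyL_row_tailOpt 15 (by norm_num) 66440 66440 66440 le_rfl (by norm_num) (by decide +kernel) le_rfl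
    (by norm_num) (by decide +kernel) (by norm_num) (by norm_num) (by decide +kernel) Explicit.key_sixteen_indepS_row hprev

/-- **THE LEVEL-16 SHARP ROW FROM `66 440`**: C-025 at level `16` for every finite matroid and every `p ≥ 66 440` (was
`73 807` at the fixed Chernoff pair, `153 192` quartic, `807 858` saturated) — the step `c025_sixteen_indepS_step` on the
level-15 row `c025_fifteen_indepS_from_33419` (`33 419 ≤ p`) at `p − 1`. -/
theorem c025_sixteen_indepS_from_66440 (M : Matroid α) [M.Finite] (p : ℕ) (hp : 66440 ≤ p) : RLS M p 16 :=
  c025_sixteen_indepS_step (fun M' _ p' hp' => c025_fifteen_indepS_from_33419 M' p' (by omega)) M p hp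

/-- The same in the literal `C025` body: `phiK p 16 · #U(p, 16) ≤ #Y(p, 16)` for every finite matroid and every `p ≥ 66 440`. -/
theorem c025_sixteen_indepS_from_66440' (M : Matroid α) [M.Finite] (p : ℕ) (hp : 66440 ≤ p) :
    phiK p 16 * ({A : Set α | A ⊆ M.E ∧ M.eRk A = (p : ℕ∞) ∧ M.eRk (M.E \ A) = (16 : ℕ∞)}.ncard : ℚ) ≤
      ({A : Set α | A ⊆ M.E ∧ (16 : ℕ∞) < M.eRk A ∧ M.eRk A < (p : ℕ∞)}.ncard : ℚ) :=
  c025_sixteen_indepS_from_66440 M p hp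

/-- **THE SHARP THEOREM-M FLOOR TABLE**: `1 165 / 2 236 / 4 349 / 8 536 / 16 856 / 33 419 / 66 440` at `q = 10 … 16`, THEOREM U's `q·2^{q+1} + 1` elsewhere. -/
def PfloorLS (q : ℕ) : ℕ :=
  if q = 10 then 1165 else if q = 11 then 2236 else if q = 12 then 4349 else if q = 13 then 8536
  else if q = 14 then 16856 else if q = 15 then 33419 else if q = 16 then 66440 else q * 2 ^ (q + 1) + 1

/-- `PfloorLS q ≤ PfloorC q` at every level: the sharp THEOREM-M table is never above the cubic one (hence not above the
saturated `Pfloor`). -/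
theorem PfloorLS_le_PfloorC (q : ℕ) : PfloorLS q ≤ PfloorC q := by
  unfold PfloorLS PfloorC
  split_ifs with h10 h11 h12 h13 h14 h15 h16 <;> subst_vars <;> norm_num

/-- `PfloorLS q ≤ Pfloor q` at every level. -/
theorem PfloorLS_le_Pfloor (q : ℕ) : PfloorLS q ≤ Pfloor q := (PfloorLS_le_PfloorC q).trans (PfloorC_le_Pfloor q)

/-- `PfloorLS q ≤ q·2^{q+1} + 1` at every level. -/
theorem PfloorLS_le (q : ℕ) : PfloorLS q ≤ q * 2 ^ (q + 1) + 1 := (PfloorLS_le_Pfloor q).trans (Pfloor_le q)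

/-- **C-025 AT EVERY LEVEL `q ≥ 7` FROM THE SHARP TABLE**: `RLS M p q` for every finite matroid and every `p ≥ PfloorLS q`. -/
theorem c025_floorLS (q : ℕ) (hq : 7 ≤ q) (M : Matroid α) [M.Finite] (p : ℕ) (hp : PfloorLS q ≤ p) : RLS M p q := by
  unfold PfloorLS at hp
  split_ifs at hp with h10 h11 h12 h13 h14 h15 h16
  · subst h10; exact c025_ten_indepS_from_1165 M p hp
  · subst h11; exact c025_eleven_indepS_from_2236 M p hp
  · subst h12; exact c025_twelve_indepS_from_4349 M p hp
  · subst h13; exact c025_thirteen_indepS_from_8536 M p hp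
  · subst h14; exact c025_fourteen_indepS_from_16856 M p hp
  · subst h15; exact c025_fifteen_indepS_from_33419 M p hp
  · subst h16; exact c025_sixteen_indepS_from_66440 M p hp
  · exact c025_lin2_seven_up q hq M p hp

/-- **THE CRUX IS ITS WINDOWS BELOW THE SHARP TABLE**: `C025` follows from `RLS M p q` on the windows `q + 2 ≤ p < PfloorLS q`. -/
theorem c025_of_window_floorLS
    (hwin : ∀ {α : Type} (M : Matroid α) [M.Finite] (p q : ℕ), q + 2 ≤ p → p < PfloorLS q →
      phiK p q * ({A : Set α | A ⊆ M.E ∧ M.eRk A = (p : ℕ∞) ∧ M.eRk (M.E \ A) = (q : ℕ∞)}.ncard : ℚ) ≤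
        ({A : Set α | A ⊆ M.E ∧ (q : ℕ∞) < M.eRk A ∧ M.eRk A < (p : ℕ∞)}.ncard : ℚ)) : C025 := by
  refine c025_of_window ?_
  intro β M _ p q hpq hT
  rcases Nat.lt_or_ge p (PfloorLS q) with h | h
  · exact hwin M p q hpq h
  · rcases Nat.lt_or_ge q 7 with hq | hq
    · exfalso
      have : PfloorLS q = q * 2 ^ (q + 1) + 1 := by
        unfold PfloorLS
        split_ifs <;> omega
      omega
    · exact c025_floorLS q hq M p h

/-- The sharp windows at `q = 10 … 16`: `PfloorLS 10 = 1 165`, …, `PfloorLS 16 = 66 440`. -/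
theorem PfloorLS_values : PfloorLS 10 = 1165 ∧ PfloorLS 11 = 2236 ∧ PfloorLS 12 = 4349 ∧ PfloorLS 13 = 8536 ∧ PfloorLS 14 = 16856 ∧ PfloorLS 15 = 33419 ∧ PfloorLS 16 = 66440 := by
  unfold PfloorLS; norm_num

end ThmN

end PercRepro
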